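import Literature.Computability.Complexity.ConstantDepthIMMProofs
import Literature.Computability.AlgebraicComplexity.DepthThreeChasmCircuits
import Literature.Computability.AlgebraicComplexity.CircuitGateSemantics
import Literature.Computability.AlgebraicComplexity.IMMInVPProofs
import Literature.Computability.AlgebraicComplexity.ArithCircuitProofs
import HarnessLib

/-!
# Barrier catalogue `ValiantsHypothesis`: the chasm at depth THREE is tight in the low-degree
regime (Limaye–Srinivasan–Tavenas 2021/2025, Cor. 4 at product-depth `Δ = 1`)

D-0021 barrier entry for the summit `ValiantsHypothesis` (`VP_ℂ ≠ VNP_ℂ`), sub-approach "depth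
reduction to depth THREE + depth-3 lower bounds" (route `ValiantsHypothesis/ChowBorderDepth3`,
`Depth3Thesis`, `SummationBits`; companion of `DepthReductionChasm` /
`DepthReductionChasmDepthFour`, which concern depth four). Everything here is PROVED; the file
introduces no named fact (the barrier `DepthThreeChasmTight` comes with
`depthThreeChasmTight_holds`, the technique class `ImprovedDepthThreeChasm` with its refutation
`not_improvedDepthThreeChasm`).

**The printed results** (checked with `lit read` on the held text
`paper:doi-10-1109-focs52979-2021-00083` = J. ACM 72 (2025), Art. 26).

* Limaye–Srinivasan–Tavenas, Cor. 4 (p. 26:5): "Assume `d ≤ (log n)/100` and `char(𝔽) = 0` or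
  greater than `d`. For any product-depth `Δ ≥ 1`, any algebraic circuit `C` computing `IMM_{n,d}`
  of product-depth at most `Δ` must have size at least `n^{d^{exp(-O(Δ))}}`. In the particular
  case that `Δ = 1`, the size of `C` must be at least `n^{Ω(√d)}`." And the remark right after
  it: "In the case `Δ = 1`, our bound is actually tight, by a beautiful upper bound due to Gupta,
  Kamath, Kayal, and Saptharishi [25]." Tree: `lst_constantDepth_imm_lower_bound`
  (`ConstantDepthIMM.lean`, rendering `size ≥ n^{d^δ}` for `d₀ ≤ d ≤ ε log n`, unspecified
  `δ > 0`), PROVED (`lst_constantDepth_imm_lower_bound_holds`, `ConstantDepthIMMProofs.lean`).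
* Gupta–Kamath–Kayal–Saptharishi, SIAM J. Comput. 45 (2016) (= FOCS 2013), Thm. 1.1: an
  `n`-variate polynomial of degree `d = n^{O(1)}` with circuits of size `s` has `ΣΠΣ` circuits of
  size `2^{O(√(d log n log s log d))}` (size = wires, §3); Tavenas, Inform. and Comput. 240 (2015),
  Cor. 1: `2^{O(√(d log n log s))}`. Tree: `gkks_sigmaPiSigma_edgeSize_le_of_complexity`,
  `sigmaPiSigma_edgeSize_le_of_complexity` (`DepthThreeChasm.lean`, named facts), whose shape
  (`∀ a, ∃ K, ∀ n s d f, deg f ≤ d ≤ n^a + a → L(f) ≤ s → ∃ P, ΣΠΣ, wires ≤ …`) the technique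
  class below copies with a smaller bound.

**What this file does** (over `ℂ`; `edgeSize` = wires, `size` = gates, `productDepth ≤ 1` =
`ΣΠΣ` in the unbounded-fan-in model of `ArithCircuit`).

1. *Few-gates `ΣΠΣ` normal form* (`exists_size_le_of_productDepth_le_one`): a circuit of
   product-depth `≤ 1` with `E` wires over finitely many variables is recomputed by a `ΣΠΣ`
   circuit with at most `(E + 2)²` GATES. Needed because the technique class bounds wires
   (GKKS's size) while LST bound gates, and in the tree's model `size ≤ edgeSize + 1` fails
   (gates of fan-in `0`, dead gates). Proof: sum closure `ArithCircuit.gateVal_mem_span_spanFamily`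
   (`CircuitGateSemantics.lean`) writes the output as a linear combination of `1`, variables and
   values of product gates of product-depth `1`; their operands denote affine forms
   (`exists_affVal_opVal`); at most `E` product gates have an operand
   (`card_filter_fanIn_pos_le`), each of fan-in `≤ E`; the canonical builder `spsCircuit` of
   `DepthThreeChasmCircuits.lean` on these data has `T·D + T + 1 ≤ (E+2)²` gates
   (`size_spsCircuit`, `exists_sps_circuit_size`).
2. *Technique class* `ImprovedDepthThreeChasm` (typed verbatim as filed by the planner of
   `route-ValiantsHypothesis-ChowBorderDepth3`): `ΣΠΣ` wires `≤ (s+2)^K · 2^{K⌊√d⌋+K}`, i.e. the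
   GKKS/Tavenas exponent with the factor `√(log n log s)` removed, uniformly in `d`.
3. *Barrier* `DepthThreeChasmTight` — Cor. 4 at `Δ = 1` in the currency of the class: for every
   `K` some `IMM_{n,d}` needs more than `(L(IMM_{n,d}) + 2)^K · 2^{K⌊√d⌋+K}` wires at
   product-depth `1` — derived from the LST fact (`depthThreeChasmTight_of_lst`: `d` large,
   `n = ⌈e^{d/ε}⌉`, the normal form, and the arithmetic `chasm_arith`:
   `((n + 2n³d + 2)^K 2^{K√d+K} + 2)² = e^{O(d)} < e^{d^{1+δ}/ε} ≤ n^{d^δ}`), hence PROVED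
   (`depthThreeChasmTight_holds`); and the refutations
   `DepthThreeChasmTight.not_improvedDepthThreeChasm` (apply the class with `a = 1` to `IMM_{n,d}`
   renamed to `Fin (d n²)` variables, `complexity_rename_le_holds'`, and rename the circuit back:
   `edgeSize_rename`, `productDepth_rename`), `depthThreeChasmTight` (from the LST fact, the
   form filed) and `not_improvedDepthThreeChasm` (unconditional).

**Not done here** (recorded for the librarian): the `scope_caveats` line of the sibling
`DepthReductionChasm` ("nothing is printed about tightness of the reductions … to depth three")
predates this entry; it should now point to LST Cor. 4 (`Δ = 1`) and the remark after it, i.e. to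
`DepthThreeChasmTight` — tight in the regime `d ≤ ε log n`; for `d ≥ n^{Ω(1)}` nothing is printed.

## References

* [LimayeSrinivasanTavenas2025] N. Limaye, S. Srinivasan, S. Tavenas, *Superpolynomial lower
  bounds against low-depth algebraic circuits*, J. ACM 72 (2025), Art. 26 (FOCS 2021), Cor. 4 and
  the remark following it (p. 26:5); §1–§2 (product-depth, size).
* [GuptaKamathKayalSaptharishi2016] A. Gupta, P. Kamath, N. Kayal, R. Saptharishi, *Arithmetic
  circuits: a chasm at depth three*, SIAM J. Comput. 45 (2016) 1064–1079 (FOCS 2013; ECCC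
  TR13-026), Thm. 1.1, §1 (eq. (1), consequences for the permanent), §3 (size = wires).
* [Tavenas2015] S. Tavenas, *Improved bounds for reduction to depth 4 and depth 3*, Inform. and
  Comput. 240 (2015) 2–11, Cor. 1.
* [KumarSaraf2017] M. Kumar, S. Saraf, SIAM J. Comput. 46 (2017), §3 (`IMM ∈ VP`, the circuit
  behind `complexity_immPoly_le`).
-/

noncomputable section

namespace Literature.Barriers.ValiantsHypothesis

open Literature.Computability.AlgebraicComplexity Literature.Computability.Complexity
open ArithCircuit DepthThreeChasm MvPolynomial

universe u v

/-! ### A `ΣΠΣ` normal form with few GATES for circuits of product-depth `≤ 1` -/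

section NormalForm

variable {k : Type u} {σ : Type v}

/-- The `ΣΠΣ` builder `spsCircuit T D c ℓ` has `T · D + T + 1` gates. [folklore] -/
theorem size_spsCircuit [CommSemiring k] [Fintype σ] (T D : ℕ) (c : Fin T → k)
    (ℓ : Fin T → Fin D → (σ → k) × k) : (spsCircuit T D c ℓ).size = T * D + T + 1 := by
  simp [spsCircuit, ArithCircuit.size, length_layerA, length_layerB, Nat.add_assoc]

/-- The list-fed `ΣΠΣ` builder with its GATE count: `#𝒯` terms `c_τ · ∏ (A τ)` of at most `D`
affine factors each are computed at product-depth `≤ 1` by `#𝒯 · D + #𝒯 + 1` gates (same circuit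
as `DepthThreeChasm.exists_sps_circuit`, which records the wire count).
[cite: GuptaKamathKayalSaptharishi2016, §1 eq. (1)] -/
theorem exists_sps_circuit_size [CommSemiring k] [Fintype σ] {𝒯 : Type*} [Fintype 𝒯] (D : ℕ)
    (c : 𝒯 → k) (A : 𝒯 → List ((σ → k) × k)) (hA : ∀ τ, (A τ).length ≤ D) :
    ∃ C : ArithCircuit k σ, C.eval = ∑ τ, c τ • ((A τ).map affVal).prod ∧
      C.productDepth ≤ 1 ∧ C.size = Fintype.card 𝒯 * D + Fintype.card 𝒯 + 1 := by
  classical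
  set T := Fintype.card 𝒯 with hT
  set e := Fintype.equivFin 𝒯 with he
  set c' : Fin T → k := fun τ => c (e.symm τ) with hc'
  set ℓ' : Fin T → Fin D → (σ → k) × k := fun τ π => (A (e.symm τ)).getD π.val (0, 1) with hℓ'
  refine ⟨spsCircuit T D c' ℓ', ?_, productDepth_spsCircuit_le T D c' ℓ', size_spsCircuit T D c' ℓ'⟩
  rw [eval_spsCircuit, ← e.symm.sum_comp]
  refine Fintype.sum_congr _ _ fun τ => ?_
  simp only [hc', hℓ']
  rw [prod_affVal_getD _ _ (hA _)]

/-- A product gate has product-depth at least `1` (universe-polymorphic copy of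
`LSTWord.one_le_gatePD_of_prod`, which is stated for `σ₀ : Type` only).
[cite: LimayeSrinivasanTavenas2025, §1] -/
theorem one_le_gatePD_of_prod_gate (P : ArithCircuit k σ) {j : ℕ} {args : List (Operand k σ)}
    (hg : P.gates[j]? = some (.prod args)) : 1 ≤ P.gatePD j := by
  unfold ArithCircuit.gatePD
  rw [List.getD_eq_getElem?_getD, gateWDepths_getElem? prodWeight P.gates j _ hg, Option.getD_some]
  simp [prodWeight, Gate.isProd]

/-- At product-depth `0` the spanning family consists of the variables and `1` only, so a member
of its span is an AFFINE form `∑ᵥ aᵥ Xᵥ + b`. [folklore] -/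
theorem exists_affVal_of_mem_span_spanFamily_zero [CommSemiring k] [Fintype σ]
    (P : ArithCircuit k σ) {x : MvPolynomial σ k}
    (hx : x ∈ Submodule.span k (Set.range (P.spanFamily 0))) :
    ∃ φ : (σ → k) × k, x = affVal φ := by
  classical
  obtain ⟨c, rfl⟩ := (Submodule.mem_span_range_iff_exists_fun k).1 hx
  have h0 : ∀ j : Fin P.size, P.spanFamily 0 (.inl j) = 0 := fun j => by
    rcases P.spanFamily_inl_eq 0 j with h | ⟨⟨args, hargs⟩, hpd, -⟩
    · exact h
    · exact absurd hpd (Nat.not_le.2 (one_le_gatePD_of_prod_gate P hargs))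
  refine ⟨(fun v => c (.inr (.inl v)), c (.inr (.inr ()))), ?_⟩
  rw [Fintype.sum_sum_type, Fintype.sum_sum_type, affVal_apply]
  simp only [h0, smul_zero, Finset.sum_const_zero, zero_add]
  simp [ArithCircuit.spanFamily, MvPolynomial.C_eq_smul_one, Finset.univ_unique, Finset.sum_singleton]

/-- An operand of product-depth `0` denotes an affine form (variables, constants, and sum gates
above no product gate). [folklore] -/
theorem exists_affVal_opVal [CommSemiring k] [Fintype σ] [DecidableEq σ] (P : ArithCircuit k σ)
    (i : ℕ) (u : Operand k σ) (hu : P.opPD i u = 0) :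
    ∃ φ : (σ → k) × k, P.opVal i u = affVal φ := by
  classical
  cases u with
  | var v =>
    refine ⟨(Pi.single v 1, 0), ?_⟩
    rw [opVal_var, affVal_apply, map_zero, add_zero, Finset.sum_eq_single v]
    · simp
    · intro j _ hj
      simp [hj]
    · simp
  | const c => exact ⟨(0, c), by simp [affVal_apply]⟩
  | gate j =>
    rw [opVal_gate]
    split_ifs with hji
    · have hpd : P.gatePD j = 0 := by simpa [ArithCircuit.opPD, hji] using hu
      have hmem := P.gateVal_mem_span_spanFamily j
      rw [hpd] at hmem
      exact exists_affVal_of_mem_span_spanFamily_zero P hmem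
    · exact ⟨(0, 0), by simp [affVal_apply]⟩

/-- The wire count is the sum of the fan-ins, gate by gate. [cite: LimayeSrinivasanTavenas2025, §2] -/
theorem edgeSize_eq_sum_fanIn (P : ArithCircuit k σ) :
    P.edgeSize = ∑ j : Fin P.size, (P.gates[(j : ℕ)]).fanIn := by
  unfold ArithCircuit.edgeSize ArithCircuit.size
  rw [← List.sum_ofFn]
  change _ = (List.ofFn (Gate.fanIn ∘ fun j : Fin P.gates.length => P.gates[(j : ℕ)])).sum
  rw [← List.map_ofFn, List.ofFn_getElem]

/-- Each gate's fan-in is at most the wire count. [cite: LimayeSrinivasanTavenas2025, §2] -/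
theorem fanIn_le_edgeSize (P : ArithCircuit k σ) (j : Fin P.size) :
    (P.gates[(j : ℕ)]).fanIn ≤ P.edgeSize := by
  rw [edgeSize_eq_sum_fanIn]
  exact Finset.single_le_sum (f := fun j : Fin P.size => (P.gates[(j : ℕ)]).fanIn)
    (fun _ _ => Nat.zero_le _) (Finset.mem_univ j)

/-- **At most `edgeSize` gates have positive fan-in** (each contributes a wire).
[cite: LimayeSrinivasanTavenas2025, §2] -/
theorem card_filter_fanIn_pos_le (P : ArithCircuit k σ) :
    (Finset.univ.filter fun j : Fin P.size => 1 ≤ (P.gates[(j : ℕ)]).fanIn).card ≤ P.edgeSize := by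
  rw [edgeSize_eq_sum_fanIn, Finset.card_eq_sum_ones]
  exact (Finset.sum_le_sum fun j hj => (Finset.mem_filter.1 hj).2).trans
    (Finset.sum_le_sum_of_subset (Finset.filter_subset _ _))

/-- **Few-gates `ΣΠΣ` normal form.** A circuit `P` of product-depth `≤ 1` over finitely many
variables computes the same polynomial as a `ΣΠΣ` circuit with at most `(edgeSize P + 2)²`
GATES: by sum closure (`ArithCircuit.gateVal_mem_span_spanFamily`) the output is a linear
combination of `1`, the variables and the values of the product gates of product-depth `1`, whose
operands denote affine forms; product gates with no operand denote `1`; there are at most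
`edgeSize P` product gates with an operand and each has fan-in `≤ edgeSize P`, so the canonical
`ΣΠΣ` circuit on these data (`spsCircuit`) has `≤ (E+1)(E+1) + (E+1) + 1 ≤ (E+2)²` gates. (In
the tree's model gates may have fan-in `0` and dead gates are counted by `size`, so `size ≤
edgeSize + 1` fails in general; this lemma is the replacement.) [folklore] -/
theorem exists_size_le_of_productDepth_le_one [CommSemiring k] [Fintype σ] [DecidableEq σ]
    (P : ArithCircuit k σ) (hP : P.productDepth ≤ 1) :
    ∃ Q : ArithCircuit k σ, Q.eval = P.eval ∧ Q.productDepth ≤ 1 ∧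
      Q.size ≤ (P.edgeSize + 2) ^ 2 := by
  classical
  -- (1) sum closure at the output
  have hmem : P.eval ∈ Submodule.span k (Set.range (P.spanFamily 1)) := by
    rw [eval_eq_opVal_output]
    cases hout : P.output with
    | var v => exact Submodule.subset_span ⟨.inr (.inl v), rfl⟩
    | const c =>
      rw [opVal_const, MvPolynomial.C_eq_smul_one]
      exact Submodule.smul_mem _ _ (Submodule.subset_span ⟨.inr (.inr ()), rfl⟩)
    | gate j =>
      rw [opVal_gate]
      split_ifs with hj
      · have hpd : P.gatePD j ≤ 1 := by
          have h := P.productDepth_eq_opPD_output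
          rw [hout, opPD_gate, if_pos hj] at h
          rw [← h]
          exact hP
        exact P.span_spanFamily_mono hpd (P.gateVal_mem_span_spanFamily j)
      · exact Submodule.zero_mem _
  obtain ⟨c, hc⟩ := (Submodule.mem_span_range_iff_exists_fun k).1 hmem
  -- (2) affine factors of the operands of product-depth `0`
  have haff : ∀ (i : ℕ) (u : Operand k σ), ∃ φ : (σ → k) × k,
      P.opPD i u = 0 → P.opVal i u = affVal φ := by
    intro i u
    by_cases h : P.opPD i u = 0
    · obtain ⟨φ, hφ⟩ := exists_affVal_opVal P i u h
      exact ⟨φ, fun _ => hφ⟩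
    · exact ⟨(0, 0), fun h' => absurd h' h⟩
  choose Φ hΦ using haff
  -- (3) the terms
  set E := P.edgeSize with hE
  let good : Fin P.size → Prop := fun j =>
    P.gateIsProd j = true ∧ P.gatePD j ≤ 1 ∧ 1 ≤ (P.gates[(j : ℕ)]).fanIn
  let unitGood : Fin P.size → Prop := fun j =>
    P.gateIsProd j = true ∧ P.gatePD j ≤ 1 ∧ (P.gates[(j : ℕ)]).fanIn = 0
  let b : k := c (.inr (.inr ())) + ∑ j ∈ Finset.univ.filter unitGood, c (.inl j)
  let φ₀ : (σ → k) × k := (fun v => c (.inr (.inl v)), b)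
  let 𝒯 := {j : Fin P.size // good j} ⊕ Unit
  let coef : 𝒯 → k := Sum.elim (fun j => c (.inl j.1)) (fun _ => 1)
  let A : 𝒯 → List ((σ → k) × k) :=
    Sum.elim (fun j => ((P.gates[(j.1 : ℕ)]).args).map (Φ j.1)) (fun _ => [φ₀])
  have hlen : ∀ τ, (A τ).length ≤ E + 1 := by
    rintro (j | u)
    · simp only [A, Sum.elim_inl, List.length_map]
      exact (fanIn_le_edgeSize P j.1).trans (Nat.le_succ _)
    · simp [A]
  obtain ⟨Q, hQe, hQpd, hQs⟩ := exists_sps_circuit_size (E + 1) coef A hlen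
  -- values of the good product gates
  have hval : ∀ j : Fin P.size, good j →
      (((P.gates[(j : ℕ)]).args.map (Φ j)).map affVal).prod = P.gateVal j := by
    rintro j ⟨hjp, hjpd, -⟩
    obtain ⟨args, hg⟩ := (P.gateIsProd_iff j).1 hjp
    have hget : P.gates[(j : ℕ)] = .prod args := by
      have := List.getElem?_eq_getElem j.2 ▸ hg
      exact Option.some_injective _ this
    have hargs : (P.gates[(j : ℕ)]).args = args := by
      rw [hget]
      rfl
    rw [P.gateVal_of_prod hg, hargs, List.map_map]
    refine congrArg List.prod (List.map_congr_left fun u hu => ?_)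
    have hop : P.opPD j u = 0 := by
      have := P.opPD_succ_le_gatePD_of_prod hg hu
      omega
    exact (hΦ j u hop).symm
  -- values of the operand-free product gates
  have hunit : ∀ j : Fin P.size, unitGood j → P.gateVal j = 1 := by
    rintro j ⟨hjp, -, hj0⟩
    obtain ⟨args, hg⟩ := (P.gateIsProd_iff j).1 hjp
    have hget : P.gates[(j : ℕ)] = .prod args := by
      have := List.getElem?_eq_getElem j.2 ▸ hg
      exact Option.some_injective _ this
    have hnil : args = [] := by
      rw [hget] at hj0
      exact List.eq_nil_of_length_eq_zero hj0
    rw [P.gateVal_of_prod hg, hnil, List.map_nil, List.prod_nil]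
  refine ⟨Q, ?_, hQpd, ?_⟩
  · -- (4) the value
    have hsplit : ∀ j : Fin P.size, c (.inl j) • P.spanFamily 1 (.inl j) =
        (if good j then c (.inl j) • P.gateVal j else 0) +
          (if unitGood j then c (.inl j) • (1 : MvPolynomial σ k) else 0) := by
      intro j
      by_cases hp : P.gateIsProd j = true ∧ P.gatePD j ≤ 1
      · have hsf : P.spanFamily 1 (.inl j) = P.gateVal j := by
          simp [ArithCircuit.spanFamily, hp]
        rw [hsf]
        rcases Nat.eq_zero_or_pos ((P.gates[(j : ℕ)]).fanIn) with h0 | hpos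
        · have hu : unitGood j := ⟨hp.1, hp.2, h0⟩
          have hng : ¬ good j := fun hg' => by
            have := hg'.2.2
            omega
          rw [if_neg hng, if_pos hu, hunit j hu, zero_add]
        · have hg' : good j := ⟨hp.1, hp.2, hpos⟩
          have hnu : ¬ unitGood j := fun hu => by
            have := hu.2.2
            omega
          rw [if_pos hg', if_neg hnu, add_zero]
      · have hsf : P.spanFamily 1 (.inl j) = 0 := by
          simp only [ArithCircuit.spanFamily]
          rw [if_neg hp]
        have hng : ¬ good j := fun hg' => hp ⟨hg'.1, hg'.2.1⟩
        have hnu : ¬ unitGood j := fun hu => hp ⟨hu.1, hu.2.1⟩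
        rw [hsf, if_neg hng, if_neg hnu, smul_zero, add_zero]
    have hsum1 : ∑ j : Fin P.size, c (.inl j) • P.spanFamily 1 (.inl j) =
        (∑ j : {j : Fin P.size // good j}, c (.inl j.1) • P.gateVal j.1) +
          (∑ j ∈ Finset.univ.filter unitGood, c (.inl j)) • (1 : MvPolynomial σ k) := by
      rw [Finset.sum_congr rfl fun j _ => hsplit j, Finset.sum_add_distrib, ← Finset.sum_filter,
        ← Finset.sum_filter, ← Finset.sum_smul]
      congr 1
      exact (Finset.sum_subtype (Finset.univ.filter good) (by simp)
        (fun j : Fin P.size => c (.inl j) • P.gateVal j))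
    have hL1 : ∑ j : {j : Fin P.size // good j}, coef (.inl j) • ((A (.inl j)).map affVal).prod =
        ∑ j : {j : Fin P.size // good j}, c (.inl j.1) • P.gateVal j.1 :=
      Fintype.sum_congr _ _ fun j => by
        simp only [coef, A, Sum.elim_inl]
        rw [hval j.1 j.2]
    have hL2 : ∑ u : Unit, coef (.inr u) • ((A (.inr u)).map affVal).prod = affVal φ₀ := by
      simp [coef, A]
    have hR2 : ∑ v : σ, c (.inr (.inl v)) • P.spanFamily 1 (.inr (.inl v)) =
        ∑ v : σ, c (.inr (.inl v)) • (X v : MvPolynomial σ k) := rfl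
    have hR3 : ∑ u : Unit, c (.inr (.inr u)) • P.spanFamily 1 (.inr (.inr u)) =
        c (.inr (.inr ())) • (1 : MvPolynomial σ k) := by
      simp [ArithCircuit.spanFamily]
    have hφ₀ : affVal φ₀ = ∑ v : σ, c (.inr (.inl v)) • (X v : MvPolynomial σ k) +
        (c (.inr (.inr ())) • (1 : MvPolynomial σ k) +
          (∑ j ∈ Finset.univ.filter unitGood, c (.inl j)) • (1 : MvPolynomial σ k)) := by
      simp only [φ₀, b]
      rw [affVal_apply, MvPolynomial.C_eq_smul_one, add_smul]
    rw [hQe, ← hc, Fintype.sum_sum_type, hL1, hL2, Fintype.sum_sum_type, Fintype.sum_sum_type,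
      hsum1, hR2, hR3, hφ₀]
    abel
  · -- (5) the size
    rw [hQs]
    have hT : Fintype.card 𝒯 ≤ E + 1 := by
      simp only [𝒯, Fintype.card_sum, Fintype.card_unit, Fintype.card_subtype]
      refine Nat.add_le_add_right ((Finset.card_le_card ?_).trans (card_filter_fanIn_pos_le P)) 1
      intro j hj
      simp only [Finset.mem_filter, Finset.mem_univ, true_and, good] at hj ⊢
      exact hj.2.2
    calc Fintype.card 𝒯 * (E + 1) + Fintype.card 𝒯 + 1
        ≤ (E + 1) * (E + 1) + (E + 1) + 1 := by gcongr
      _ ≤ (E + 2) ^ 2 := by nlinarith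

end NormalForm

/-! ### The technique class: a `poly(s) · 2^{O(√d)}` `ΣΠΣ` simulation of `VP` -/

/-- REFUTED TECHNIQUE CLASS — not a literature fact and not debt in substance: its NEGATION is the
theorem `not_improvedDepthThreeChasm` below (D-0026 accounting nevertheless counts the bare
`Prop`). **The door this barrier closes: an improved depth-3 chasm.** For every
exponent `a` there is `K` such that every `f : MvPolynomial (Fin n) ℂ` of total degree `≤ d` with
`d ≤ n^a + a` and fan-in-two complexity `≤ s` has a circuit of product-depth `≤ 1` (`ΣΠΣ`) with
at most `(s + 2)^K · 2^{K ⌊√d⌋ + K}` wires — the shape of the tree's rendering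
`sigmaPiSigma_edgeSize_le_of_complexity` of the printed depth-3 chasm "if `f` is an `n`-variate
polynomial of degree `d = n^{O(1)}` computed by a circuit of size `s`, then `f` can also be
computed by a `ΣΠΣ` circuit of size `2^{O(√(d log n log s))}`" [cite: Tavenas2015, Cor. 1]
(and `2^{O(√(d log n log s log d))}` [cite: GuptaKamathKayalSaptharishi2016, Thm. 1.1]) with the
factor `√(log n · log s)` REMOVED from the exponent, uniformly in `d`. Refuted below
(`not_improvedDepthThreeChasm`). [cite: GuptaKamathKayalSaptharishi2016, Thm. 1.1] -/
def ImprovedDepthThreeChasm : Prop :=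
  ∀ a : ℕ, ∃ K : ℕ, ∀ (n s d : ℕ) (f : MvPolynomial (Fin n) ℂ),
    f.totalDegree ≤ d → d ≤ n ^ a + a → complexity f ≤ s →
      ∃ P : ArithCircuit ℂ (Fin n), P.Computes f ∧ P.productDepth ≤ 1 ∧
        P.edgeSize ≤ (s + 2) ^ K * 2 ^ (K * Nat.sqrt d + K)

/-! ### The arithmetic of the refutation -/
set_option maxHeartbeats 400000 in -- buildfix (bf3-g27): 160k/180k FAIL, 200k PASS at accept time; line-neutral budget line
/-- **The final arithmetic.** For all `K`, `δ, ε > 0` and `d₀` there are `d ≥ max d₀ 1` and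
`n ≥ 1` with `d ≤ ε log n` (namely `n = ⌈e^{d/ε}⌉`) such that
`((n + 2n³d + 2)^K · 2^{K⌊√d⌋+K} + 2)² < n^{d^δ}`: the left-hand side is `e^{O(d)}` while the
right-hand side is `e^{d^{1+δ}/ε}`. [folklore] -/
theorem chasm_arith (K : ℕ) {δ ε : ℝ} (hδ : 0 < δ) (hε : 0 < ε) (d₀ : ℕ) :
    ∃ d n : ℕ, d₀ ≤ d ∧ 1 ≤ d ∧ 1 ≤ n ∧ (d : ℝ) ≤ ε * Real.log n ∧
      ((((n + 2 * n ^ 3 * d + 2) ^ K * 2 ^ (K * Nat.sqrt d + K) + 2) ^ 2 : ℕ) : ℝ) <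
        (n : ℝ) ^ ((d : ℝ) ^ δ) := by
  -- constants
  set α : ℝ := K * (3 / ε + 1 + Real.log 2) with hα
  set β : ℝ := Real.log 3 + K * (Real.log 5 + 4 * Real.log 2) with hβ
  have hlog2 : 0 ≤ Real.log 2 := Real.log_nonneg (by norm_num)
  have hlog3 : 0 ≤ Real.log 3 := Real.log_nonneg (by norm_num)
  have hlog5 : 0 ≤ Real.log 5 := Real.log_nonneg (by norm_num)
  have hK0 : (0 : ℝ) ≤ K := Nat.cast_nonneg K
  have hα0 : 0 ≤ α := by positivity
  have hβ0 : 0 ≤ β := by positivity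
  set M : ℝ := 2 * ε * (α + β) + 1 with hM
  have hM0 : 0 < M := by positivity
  -- the degree
  set d : ℕ := max (max d₀ 1) ⌈M ^ δ⁻¹⌉₊ with hd
  have hd₀ : d₀ ≤ d := le_max_of_le_left (le_max_left _ _)
  have hd1 : 1 ≤ d := le_max_of_le_left (le_max_right _ _)
  have hdM : ⌈M ^ δ⁻¹⌉₊ ≤ d := le_max_right _ _
  have hd1r : (1 : ℝ) ≤ d := by exact_mod_cast hd1
  have hd0r : (0 : ℝ) < d := by linarith
  have hdδ : M ≤ (d : ℝ) ^ δ := by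
    have h1 : M ^ δ⁻¹ ≤ (d : ℝ) := (Nat.le_ceil _).trans (by exact_mod_cast hdM)
    calc M = (M ^ δ⁻¹) ^ δ := (Real.rpow_inv_rpow hM0.le hδ.ne').symm
      _ ≤ (d : ℝ) ^ δ := Real.rpow_le_rpow (Real.rpow_nonneg hM0.le _) h1 hδ.le
  -- the number of variables per matrix
  set n : ℕ := ⌈Real.exp (d / ε)⌉₊ with hn
  have hexp1 : 1 ≤ Real.exp (d / ε) := Real.one_le_exp (by positivity)
  have hnexp : Real.exp (d / ε) ≤ n := Nat.le_ceil _
  have hn1r : (1 : ℝ) ≤ n := hexp1.trans hnexp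
  have hn1 : 1 ≤ n := by exact_mod_cast hn1r
  have hn0r : (0 : ℝ) < n := by linarith
  have hn2 : (n : ℝ) ≤ 2 * Real.exp (d / ε) := by
    have := (Nat.ceil_lt_add_one (Real.exp_pos (d / ε)).le).le
    rw [← hn] at this
    linarith
  have hlogn : (d : ℝ) / ε ≤ Real.log n := by
    rw [← Real.log_exp (d / ε)]
    exact Real.log_le_log (Real.exp_pos _) hnexp
  have hlogn' : Real.log n ≤ Real.log 2 + d / ε := by
    calc Real.log n ≤ Real.log (2 * Real.exp (d / ε)) := Real.log_le_log hn0r hn2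
      _ = Real.log 2 + d / ε := by
        rw [Real.log_mul (by norm_num) (Real.exp_pos _).ne', Real.log_exp]
  refine ⟨d, n, hd₀, hd1, hn1, ?_, ?_⟩
  · -- `d ≤ ε log n`
    have := mul_le_mul_of_nonneg_left hlogn hε.le
    rwa [mul_div_cancel₀ _ hε.ne'] at this
  · -- the main inequality
    set s : ℕ := n + 2 * n ^ 3 * d with hs
    set B : ℝ := ((s + 2 : ℕ) : ℝ) ^ K * (2 : ℝ) ^ (K * Nat.sqrt d + K) with hB
    have hcast : ((((s + 2) ^ K * 2 ^ (K * Nat.sqrt d + K) + 2) ^ 2 : ℕ) : ℝ) = (B + 2) ^ 2 := by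
      rw [hB]
      push_cast
      ring
    rw [hcast]
    -- `log (s + 2) ≤ log 5 + 3 log n + log d`
    have hs5 : ((s + 2 : ℕ) : ℝ) ≤ 5 * (n : ℝ) ^ 3 * d := by
      have h1 : (n : ℝ) ≤ (n : ℝ) ^ 3 * d := by
        calc (n : ℝ) = n * 1 * 1 := by ring
          _ ≤ n * (n * n) * d := by gcongr; exact one_le_mul_of_one_le_of_one_le hn1r hn1r
          _ = (n : ℝ) ^ 3 * d := by ring
      have h2 : (1 : ℝ) ≤ (n : ℝ) ^ 3 * d := hn1r.trans h1
      push_cast [hs]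
      nlinarith
    have hs0 : (0 : ℝ) < ((s + 2 : ℕ) : ℝ) := by positivity
    have hlogs : Real.log ((s + 2 : ℕ) : ℝ) ≤ Real.log 5 + 3 * (Real.log 2 + d / ε) + d := by
      have hlogd : Real.log d ≤ d := (Real.log_le_sub_one_of_pos hd0r).trans (by linarith)
      calc Real.log ((s + 2 : ℕ) : ℝ) ≤ Real.log (5 * (n : ℝ) ^ 3 * d) := Real.log_le_log hs0 hs5
        _ = Real.log 5 + 3 * Real.log n + Real.log d := by
          rw [Real.log_mul (by positivity) hd0r.ne', Real.log_mul (by norm_num) (by positivity),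
            Real.log_pow]
          push_cast
          ring
        _ ≤ Real.log 5 + 3 * (Real.log 2 + d / ε) + d := by gcongr
    -- `log B ≤ α d + K (log 5 + 4 log 2)`
    have hB1 : 1 ≤ B := by
      rw [hB]
      refine one_le_mul_of_one_le_of_one_le (one_le_pow₀ ?_) (one_le_pow₀ (by norm_num))
      exact_mod_cast Nat.le_add_left 1 (s + 1)
    have hB0 : 0 < B := by linarith
    have hsqrt : ((Nat.sqrt d : ℕ) : ℝ) ≤ d := by exact_mod_cast Nat.sqrt_le_self d
    have hlogB : Real.log B ≤ α * d + K * (Real.log 5 + 4 * Real.log 2) := by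
      rw [hB, Real.log_mul (by positivity) (by positivity), Real.log_pow, Real.log_pow]
      push_cast
      have h1 : (K : ℝ) * Real.log ((s + 2 : ℕ) : ℝ) ≤
          K * (Real.log 5 + 3 * (Real.log 2 + d / ε) + d) := mul_le_mul_of_nonneg_left hlogs hK0
      have h2 : ((K : ℝ) * (Nat.sqrt d : ℕ) + K) * Real.log 2 ≤ (K * d + K) * Real.log 2 := by
        gcongr
      have h3 : (K : ℝ) * (Real.log 5 + 3 * (Real.log 2 + d / ε) + d) + (K * d + K) * Real.log 2 =
          α * d + K * (Real.log 5 + 4 * Real.log 2) := by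
        rw [hα]
        ring
      push_cast at h1 h2 ⊢
      linarith
    -- `log (B + 2) ≤ β + α d`
    have hlogB2 : Real.log (B + 2) ≤ α * d + β := by
      calc Real.log (B + 2) ≤ Real.log (3 * B) := Real.log_le_log (by linarith) (by linarith)
        _ = Real.log 3 + Real.log B := Real.log_mul (by norm_num) hB0.ne'
        _ ≤ α * d + β := by rw [hβ]; linarith
    -- `(B + 2)² ≤ exp (2 (α d + β))`
    have hup : (B + 2) ^ 2 ≤ Real.exp (2 * (α * d + β)) := by
      have h2 : (B + 2) ^ 2 = Real.exp (2 * Real.log (B + 2)) := by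
        rw [show (2 : ℝ) * Real.log (B + 2) = ((2 : ℕ) : ℝ) * Real.log (B + 2) by norm_num,
          Real.exp_nat_mul, Real.exp_log (by linarith)]
      rw [h2]
      exact Real.exp_le_exp.2 (by linarith)
    -- `2 (α d + β) < d^δ · d / ε`
    have hmid : 2 * (α * d + β) < (d : ℝ) ^ δ * (d / ε) := by
      have h1 : M * (d / ε) ≤ (d : ℝ) ^ δ * (d / ε) :=
        mul_le_mul_of_nonneg_right hdδ (by positivity)
      have h2 : M * (d / ε) = 2 * (α + β) * d + d / ε := by
        rw [hM]
        field_simp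
      have h3 : (0 : ℝ) < d / ε := by positivity
      have h4 : β ≤ β * d := le_mul_of_one_le_right hβ0 hd1r
      nlinarith
    -- `exp (d^δ · d / ε) ≤ n ^ (d ^ δ)`
    have hlow : Real.exp ((d : ℝ) ^ δ * (d / ε)) ≤ (n : ℝ) ^ ((d : ℝ) ^ δ) := by
      have h1 : (d : ℝ) / ε * (d : ℝ) ^ δ ≤ Real.log n * (d : ℝ) ^ δ :=
        mul_le_mul_of_nonneg_right hlogn (Real.rpow_nonneg hd0r.le δ)
      rw [Real.rpow_def_of_pos hn0r]
      exact Real.exp_le_exp.2 (by linarith [mul_comm ((d : ℝ) / ε) ((d : ℝ) ^ δ)])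
    calc (B + 2) ^ 2 ≤ Real.exp (2 * (α * d + β)) := hup
      _ < Real.exp ((d : ℝ) ^ δ * (d / ε)) := Real.exp_lt_exp.2 hmid
      _ ≤ (n : ℝ) ^ ((d : ℝ) ^ δ) := hlow

/-! ### The barrier: the depth-3 chasm is tight for `IMM` in the low-degree regime -/

/-- BARRIER (proved: `depthThreeChasmTight_holds`). **The chasm at depth three is tight**
(Limaye–Srinivasan–Tavenas, Cor. 4 at product-depth `Δ = 1`: "Assume `d ≤ (log n)/100` and
`char(𝔽) = 0` or greater than `d`. … In the particular case that `Δ = 1`, the size of `C` must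
be at least `n^{Ω(√d)}`. In the case `Δ = 1`, our bound is actually tight, by a beautiful upper
bound due to Gupta, Kamath, Kayal, and Saptharishi"), in the currency of the technique class
`ImprovedDepthThreeChasm`: for every constant `K` there are `n, d ≥ 1` such that every circuit
of product-depth `≤ 1` computing `IMM_{n,d}` (`immPoly n d ℂ`, `d n²` variables, fan-in-two
complexity `L ≤ n + 2n³d`, `complexity_immPoly_le`) has MORE than `(L + 2)^K · 2^{K⌊√d⌋+K}`
wires. Derived from the tree's rendering `lst_constantDepth_imm_lower_bound` of Cor. 4 (size
`≥ n^{d^δ}` for `d₀ ≤ d ≤ ε log n`, PROVED: `lst_constantDepth_imm_lower_bound_holds`) at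
`d = Θ(log n)`, where `(L+2)^K 2^{O(√d)} = e^{O(d)}` while `n^{d^δ} = e^{d^{1+δ}/ε}`, through the
few-gates `ΣΠΣ` normal form `exists_size_le_of_productDepth_le_one` (wires versus gates).

BARRIER
technique_class: depth-reduction, chasm-at-depth-three, improved-depth-three-chasm, sigma-pi-sigma-simulation-of-VP, fixed-exponent-depth-three-lower-bounds — the class `ImprovedDepthThreeChasm` (`ΣΠΣ` simulation of size `poly(s) · 2^{O(√d)}`, i.e. the printed `2^{O(√(d log n log s))}` [cite: Tavenas2015, Cor. 1] with the factor `√(log n log s)` removed, uniformly in `d`).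
blocks: the "improve the depth-3 reduction" way to `ValiantsHypothesis`: a `ΣΠΣ` simulation of `VP` of size `poly(s) · 2^{O(√d)}` (more generally, below every `n^{c√d}`) would make a FIXED-exponent depth-3 lower bound for `per_n` sufficient for `VP ≠ VNP`, instead of the `∀ c` target that the printed chasm requires ("a `2^{ω(√n log n)}` … lower bound for depth three circuits … computing the permanent would imply `VP ≠ VNP`") [cite: GuptaKamathKayalSaptharishi2016, Thm. 1.1 and §1]; refuted: `DepthThreeChasmTight.not_improvedDepthThreeChasm`, `not_improvedDepthThreeChasm` (unconditional), `depthThreeChasmTight` (from the LST fact, as filed).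
because: over characteristic `0`, for `d ≤ (log n)/100` every product-depth-`1` (`ΣΠΣ`) circuit computing `IMM_{n,d}` has size `n^{Ω(√d)}` [cite: LimayeSrinivasanTavenas2025, Cor. 4], and "in the case `Δ = 1`, our bound is actually tight, by a beautiful upper bound due to Gupta, Kamath, Kayal, and Saptharishi" [cite: LimayeSrinivasanTavenas2025, Cor. 4 and the remark after it (p. 26:5)] — `IMM_{n,d}` has `poly(nd)`-size circuits, so GKKS/Tavenas give `ΣΠΣ` size `2^{O(√(d log n log(nd)))} = n^{O(√d)}` [cite: Tavenas2015, Cor. 1]; at `d = Θ(log n)` a `poly(s) · 2^{O(√d)}` simulation would have only `n^{O(1)} · 2^{O(√log n)} = n^{O(1)}` wires, hence (few-gates normal form) `n^{O(1)}` gates, against `n^{Ω(√d)} = n^{Ω(√log n)}` (tree: `n^{d^δ}`).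
evasions_known: none published; the wall is stated for the low-degree regime `d ≤ ε log n` only, so an improvement of the depth-3 chasm valid only for `d ≥ n^{Ω(1)}` (the regime of the permanent, `d = √N`) is NOT excluded by anything printed — and no first lemma towards it is known either (door, no attack) [cite: GuptaKamathKayalSaptharishi2016, §1] [cite: LimayeSrinivasanTavenas2025, Cor. 4].
scope_caveats: Cor. 4 is printed with `n^{Ω(√d)}` at `Δ = 1`; the tree's rendering `lst_constantDepth_imm_lower_bound` has an unspecified exponent `n^{d^δ}`, `δ > 0`, which suffices to refute the uniform-in-`d` class `ImprovedDepthThreeChasm` (any `2^{O(d^{1+δ'})}`, `δ' < δ`, dependence would do) but NOT the finer statement "no improvement of the constant in `2^{O(√(d log n log s))}` by a factor `→ 0`", which needs the printed `δ = 1/2` [cite: LimayeSrinivasanTavenas2025, Cor. 4]; characteristic `0` (here `ℂ`; print: `char 𝔽 = 0` or `> d`); sizes: the class counts WIRES (`edgeSize`, as GKKS §3), LST count nodes/gates — bridged by `exists_size_le_of_productDepth_le_one` (`≤ (wires + 2)²` gates), so only constants move; tightness "by GKKS" is printed as a remark without a theorem number [cite: LimayeSrinivasanTavenas2025, Cor.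 4 and the remark after it (p. 26:5)]; nothing here concerns homogeneous depth three (where `IMM` and `per` need `2^{Ω(d)}`, Nisan–Wigderson) or depth four (`DepthReductionChasmDepthFour`).
status: established [cite: LimayeSrinivasanTavenas2025, Cor. 4] (tree: proved, `lst_constantDepth_imm_lower_bound_holds`, whence `depthThreeChasmTight_holds`). -/
def DepthThreeChasmTight : Prop :=
  ∀ K : ℕ, ∃ n d : ℕ, 1 ≤ n ∧ 1 ≤ d ∧
    ∀ C : ArithCircuit ℂ (Fin d × Fin n × Fin n), C.productDepth ≤ 1 →
      C.Computes (immPoly n d ℂ) →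
        (complexity (immPoly n d ℂ) + 2) ^ K * 2 ^ (K * Nat.sqrt d + K) < C.edgeSize

/-- **The barrier from the LST fact** (Cor. 4 at `Δ = 1`, tree rendering `n^{d^δ}`): take
`d ≥ d₀` large and `n = ⌈e^{d/ε}⌉`; a product-depth-`1` circuit for `IMM_{n,d}` with few wires
has a `ΣΠΣ` normal form with few gates (`exists_size_le_of_productDepth_le_one`), contradicting
`size ≥ n^{d^δ}` by `chasm_arith`. [cite: LimayeSrinivasanTavenas2025, Cor. 4] -/
theorem depthThreeChasmTight_of_lst (hL : lst_constantDepth_imm_lower_bound.{0}) :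
    DepthThreeChasmTight := by
  classical
  intro K
  obtain ⟨δ, hδ, ε, hε, d₀, hmain⟩ := hL ℂ 1 le_rfl
  obtain ⟨d, n, hd₀, hd1, hn1, hdlog, hlt⟩ := chasm_arith K hδ hε d₀
  refine ⟨n, d, hn1, hd1, fun C hCpd hCc => ?_⟩
  by_contra hle
  rw [not_lt] at hle
  obtain ⟨Q, hQe, hQpd, hQs⟩ := exists_size_le_of_productDepth_le_one C hCpd
  have hQc : Q.Computes (immPoly n d ℂ) := by
    rw [Computes, hQe]
    exact hCc
  have hlow := hmain n d hd₀ hdlog Q hQpd hQc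
  have hs : complexity (immPoly n d ℂ) ≤ n + 2 * n ^ 3 * d := complexity_immPoly_le ℂ n d
  have h1 : Q.size ≤ ((n + 2 * n ^ 3 * d + 2) ^ K * 2 ^ (K * Nat.sqrt d + K) + 2) ^ 2 := by
    refine hQs.trans (Nat.pow_le_pow_left (Nat.add_le_add_right (hle.trans ?_) 2) 2)
    exact Nat.mul_le_mul_right _ (Nat.pow_le_pow_left (by omega) K)
  have h2 : (Q.size : ℝ) ≤
      ((((n + 2 * n ^ 3 * d + 2) ^ K * 2 ^ (K * Nat.sqrt d + K) + 2) ^ 2 : ℕ) : ℝ) := by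
    exact_mod_cast h1
  exact absurd (hlow.trans h2) (not_le.2 hlt)

/-- **The depth-3 chasm is tight — unconditionally in the tree**, from the PROVED LST fact
`lst_constantDepth_imm_lower_bound_holds`. [cite: LimayeSrinivasanTavenas2025, Cor. 4] -/
theorem depthThreeChasmTight_holds : DepthThreeChasmTight :=
  depthThreeChasmTight_of_lst lst_constantDepth_imm_lower_bound_holds

/-- **The wall refutes the technique class**: apply the class (exponent `a = 1`) to `IMM_{n,d}`
renamed to `Fin (d n²)` variables and rename the resulting `ΣΠΣ` circuit back (wires and
product-depth are invariant under renaming). [cite: LimayeSrinivasanTavenas2025, Cor. 4 and the remark after it (p. 26:5)] -/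
theorem DepthThreeChasmTight.not_improvedDepthThreeChasm (h : DepthThreeChasmTight) :
    ¬ ImprovedDepthThreeChasm := by
  classical
  intro hI
  obtain ⟨K, hK⟩ := hI 1
  obtain ⟨n, d, hn1, hd1, hC⟩ := h K
  set m : ℕ := Fintype.card (Fin d × Fin n × Fin n) with hm
  set e : Fin d × Fin n × Fin n ≃ Fin m := Fintype.equivFin _ with he
  set f : MvPolynomial (Fin m) ℂ := rename e (immPoly n d ℂ) with hf
  have hdeg : f.totalDegree ≤ d :=
    (totalDegree_rename_le _ _).trans (immPoly_isHomogeneous_holds (k := ℂ) n d).totalDegree_le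
  have hdm : d ≤ m ^ 1 + 1 := by
    have hmc : m = d * (n * n) := by
      rw [hm]
      simp [Fintype.card_prod, Fintype.card_fin]
    rw [pow_one, hmc]
    have h1 : d ≤ d * (n * n) := Nat.le_mul_of_pos_right d (Nat.mul_pos hn1 hn1)
    omega
  have hcomp : complexity f ≤ complexity (immPoly n d ℂ) := complexity_rename_le_holds' _ _
  obtain ⟨P, hPc, hPpd, hPe⟩ := hK m (complexity (immPoly n d ℂ)) d f hdeg hdm hcomp
  have hP'c : (P.rename e.symm).Computes (immPoly n d ℂ) := by
    have h' := hPc.rename e.symm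
    rwa [hf, MvPolynomial.rename_rename, e.symm_comp_self, MvPolynomial.rename_id_apply] at h'
  have hP'pd : (P.rename e.symm).productDepth ≤ 1 := by
    rw [productDepth_rename]
    exact hPpd
  have hlt := hC (P.rename e.symm) hP'pd hP'c
  rw [edgeSize_rename] at hlt
  exact absurd hPe (not_le.2 hlt)

/-- **`depthThreeChasmTight`, as filed**: the LST fact (tree rendering of Cor. 4, Δ = 1) refutes
the improved depth-3 chasm. [cite: LimayeSrinivasanTavenas2025, Cor. 4 and the remark after it (p. 26:5)] -/
theorem depthThreeChasmTight (hL : lst_constantDepth_imm_lower_bound.{0}) :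
    ¬ ImprovedDepthThreeChasm :=
  (depthThreeChasmTight_of_lst hL).not_improvedDepthThreeChasm

/-- **No `poly(s) · 2^{O(√d)}` `ΣΠΣ` simulation of `VP` exists** (unconditional in the tree).
[cite: LimayeSrinivasanTavenas2025, Cor. 4 and the remark after it (p. 26:5)] -/
theorem not_improvedDepthThreeChasm : ¬ ImprovedDepthThreeChasm :=
  depthThreeChasmTight_holds.not_improvedDepthThreeChasm

end Literature.Barriers.ValiantsHypothesis

end
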